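import Summits.MatrixMultiplication.MatrixMultiplication.Theorems.ObstructionDescentUniversalOccurrenceShortLeg
import Literature.Computability.AlgebraicComplexity.BI17WordBlockSignSums

set_option linter.dupNamespace false
set_option autoImplicit false

/-!
# Universal occurrence — the two-rectangle FLOOR LAW (diagonal witnesses, block permanents) (decomp-mm · lens 3 · gen 42)

Route `route-MatrixMultiplication-ObstructionDescent` (sub-problem `MatrixMultiplication`, `ω(ℂ) = 2`); SUPPORT for the crux
`NoOccurrenceObstruction` (`P_O`, item `stmt-MatrixMultiplication-29040`) through the universal-occurrence programme
`UOCC(m,N)` / `u(N)` (NODE-g29…g41 of the decomp-mm cell, lens 3).  Nothing here proves `ω = 2` or closes an item; no `def`,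
no `sorry`, standard axioms.  Closure currency as in parts I–VIII: "the triple `(λ⁰,λ¹,λ²)` occurs for `s`" is
`isotypicSum₁ λ⁰ (isotypicSum₂ λ¹ (isotypicSum₃ λ² (s^{⊗d}))) ≠ 0`.

**Why this file (critic g19 on g41, ask (iii): "`h₁` needs a UNIFORM mechanism").**  The census of the Hilbert bases of the
Kronecker semigroups (`K(4,4,4)_{≤40}`: 1587 generators; NODE-g42 data D7) shows that the HIGH-degree generators — the only types
that can push `u(N)` above the floor — are relative SEMI-INVARIANTS: from degree `21` on, every generator of `K(4,4,4)` has a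
RECTANGULAR leg `(δ^k)`.  This file proves the first law that is UNIFORM in the format `N`, the width `δ` and the third leg `ν`
for the sector with two rectangular legs `((δ^N),(δ^N),ν)` (the `SL_N × SL_N` semi-invariants of weight `(δ,δ)` of `N`-tuples
of `N × N` matrices):

* §1 the DIAGONAL-SLICE tensors `t₀(c) = ∑ᵢ eᵢ ⊗ eᵢ ⊗ cᵢ` (`c` an `N × N` matrix of rows `cᵢ`): restrictions of `⟨N⟩`, border
  rank `≤ N` (`algBorderRank_diagSlice_le`), and their tensor powers on words (`kroneckerPow_diagSlice_self/_of_ne`);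
* §2 block-sign calculus in the word model (`wordBlockSign` = BI 2017's `ζ_e = (e₁∧⋯∧e_N)^{⊗δ}`, the highest-weight vector of
  the rectangular weight `(δ^N)` attached to a block structure `e : [Nδ] ≃ [δ] × [N]`): `ζ_e` at a block word
  (`wordBlockSign_blockWord`), and `∑_u ζ_e(u) F(u) = ∑_σ sgn(σ) F(w_σ)` over families `σ ∈ S_N^δ` (`sum_wordBlockSign_mul`);
* §3 **the evaluation law** (`pairing_diagSlice_blockSign_blockSign`): for ANY `M : Word → ℂ` on the third leg,
  `⟪ζ_e ⊗ ζ_{e'} ⊗ M, t₀(c)^{⊗Nδ}⟫ = ∑_{σ ∈ S_N^δ} sgn(σ) ζ_{e'}(w_σ) ∑_w M(w) ∏_q c_{w_σ(q), w(q)}`, and for `e' = e`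
  (`pairing_diagSlice_blockSign_eq_sum_permanent`) the signs cancel and the blocks factor into PERMANENTS:
  `⟪ζ_e ⊗ ζ_e ⊗ M, t₀(c)^{⊗Nδ}⟫ = ∑_w M(w) · ∏_{a<δ} perm (c_{i, w(a,j)})_{i,j<N}`;
* §4 **the floor law** (`occurs_unitTensor_twoRectangle_of_pairing_ne_zero`, `…_of_permanentPairing_ne_zero`): if `M` is a
  highest-weight vector of weight `ν` and the right-hand side is non-zero for one matrix `c`, then `((δ^N),(δ^N),ν)` occurs for
  `⟨m⟩` for EVERY `m ≥ N` — at the floor `m = N` of the ladder, uniformly in `N, δ, ν`.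

**Dictionary and data (NODE-g42 §2–§4; not formalised here).**  For `e' = e` the map `w ↦ ∏_a perm(c_{·,w(a,·)})` is the
full polarisation of the Chow form `(ℓ_{c_1}⋯ℓ_{c_N})^{⊗δ}`, so the right-hand side of §3 is the Hermite–Hadamard–Howe image
`h_{δ,N}(F_M)(c)` of the form `F_M` on `Sym^N ℂ^N` depolarised from `M` (Landsberg 2017, §9.1.1; tree: `hadamardHowe`, whose
kernel is `I(Ch_N)` by `hadamardHowe_eq_zero_iff`): every type `ν` of `ℂ[Ch_N(ℂ^N)]_δ` gives a floor-occurring unit-tensor type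
`((δ^N),(δ^N),ν)`.  The ORBIT CEILING is Bürgisser–Ikenmeyer's `dim (V_α ⊗ V_α ⊗ V_ν^α)^{S_N} = [Sym^N Sym^δ ℂ^N : ν]`
(2011, Thm. 4.4 with `α = (δ^N)` the only partition dominated by the rectangle): a type with this plethysm coefficient `0` lies
outside `S°(⟨N⟩) ⊇ S(⟨N⟩)`.  Data D8 of NODE-g42 (exact integer evaluations of the law of §3, block structures `e' ≠ e` allowed):
of the 65 Hilbert-basis elements of `K(4,4,4)_{≤40}` with two legs `(δ^4)`, the 28 orbit-allowed ones ALL occur for `⟨4⟩`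
(certificates), the 37 orbit-forbidden ones need `m ≥ 5`, and among those of degree `≤ 12` four occur for `⟨5⟩` and nine first
for `⟨6⟩` — the nine include BI's `((2^4),(2^4),(5,1,1,1)) ∉ S°(⟨5⟩)` (2011, Lemma 6.1), recovered by the instrument.

[cite: BurgisserIkenmeyer2011, §3.4 (Prop. 3.4), Thm. 4.4, Lemma 6.1] [cite: BurgisserIkenmeyer2017, §5, Thm. 5.9 (proof of (2)), eq. (3.4)]
[cite: Landsberg2017, §9.1.1 (Def. 9.1.1.1: Hermite–Hadamard–Howe map; Thm. 9.1.1.4: ker h = I(Ch))]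
-/

noncomputable section

open scoped BigOperators

namespace Summit.MatrixMultiplication.MatrixMultiplication.Theorems.ObstructionCalculus

open Literature.Computability.AlgebraicComplexity
open Literature.NumberTheory.DiophantineGeometry (Word Word3 wordRep highestWeightSpace Weight tripleHw mem_tripleHw_iff)

/-! ### §1 The diagonal-slice tensors `t₀(c) = ∑ᵢ eᵢ ⊗ eᵢ ⊗ cᵢ` -/

/-- `t₀(c) = (1 ⊗ 1 ⊗ cᵀ)·⟨N⟩` is a restriction of the unit tensor. [folklore] -/
theorem diagSlice_eq_actTensor {N : ℕ} (c : Fin N → Fin N → ℂ) :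
    (fun i j l : Fin N => if i = j then c i l else 0) =
      actTensor (1 : Matrix (Fin N) (Fin N) ℂ) (1 : Matrix (Fin N) (Fin N) ℂ) (Matrix.of fun l i => c i l)
        (unitTensor ℂ N) := by
  funext i j l
  simp only [actTensor_apply]
  rw [Finset.sum_eq_single i (fun a _ ha => by simp [Matrix.one_apply_ne' ha]) (by simp)]
  rw [Finset.sum_eq_single j (fun b _ hb => by simp [Matrix.one_apply_ne' hb]) (by simp)]
  by_cases hij : i = j
  · subst hij
    rw [Finset.sum_eq_single i (fun l' _ hl => by simp [unitTensor_apply, Ne.symm hl]) (by simp)]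
    simp
  · rw [if_neg hij]
    exact (Finset.sum_eq_zero fun l' _ => by simp [unitTensor_apply, hij]).symm

/-- **`R̲(t₀(c)) ≤ N`.** [folklore] -/
theorem algBorderRank_diagSlice_le {N : ℕ} (c : Fin N → Fin N → ℂ) :
    algBorderRank (fun i j l : Fin N => if i = j then c i l else 0) ≤ N := by
  rw [diagSlice_eq_actTensor]
  exact (tensorRestrictsTo_actTensor _ _ _ (unitTensor ℂ N)).algBorderRank_le.trans
    ((algBorderRank_le_tensorRank _).trans (Literature.Barriers.MatrixMultiplication.tensorRank_unitTensor_le (K := ℂ) N))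

/-- Tensor powers of `t₀(c)` on words: diagonal in the first two legs … [folklore] -/
theorem kroneckerPow_diagSlice_self {N D : ℕ} (c : Fin N → Fin N → ℂ) (u w : Word N D) :
    kroneckerPow (fun i j l : Fin N => if i = j then c i l else 0) D u u w = ∏ q, c (u q) (w q) := by
  rw [kroneckerPow_apply]
  simp

/-- … and zero off the diagonal. [folklore] -/
theorem kroneckerPow_diagSlice_of_ne {N D : ℕ} (c : Fin N → Fin N → ℂ) {u v : Word N D} (h : u ≠ v) (w : Word N D) :
    kroneckerPow (fun i j l : Fin N => if i = j then c i l else 0) D u v w = 0 := by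
  rw [kroneckerPow_apply]
  obtain ⟨q, hq⟩ : ∃ q, u q ≠ v q := by
    by_contra hc
    exact h (funext fun q => not_not.mp (not_exists.mp hc q))
  exact Finset.prod_eq_zero (Finset.mem_univ q) (by simp [hq])

/-! ### §2 Block-sign calculus -/

/-- The block sign of the block word `w_σ(q) = σ_{e(q)₁}(e(q)₂)` of a family `σ ∈ S_N^δ` is `∏_a sgn σ_a`.
[cite: BurgisserIkenmeyer2017, Thm. 5.9 (proof of (2))] -/
theorem wordBlockSign_blockWord {D δ N : ℕ} (e : Fin D ≃ Fin δ × Fin N) (σ : Fin δ → Equiv.Perm (Fin N)) :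
    wordBlockSign ℂ e (fun q => σ (e q).1 (e q).2) = ∏ a, ((Equiv.Perm.sign (σ a) : ℤ) : ℂ) := by
  rw [← sum_prod_sign_mul_ite_eq_wordBlockSign]
  rw [Finset.sum_eq_single σ]
  · simp
  · intro τ _ hτ
    rw [if_neg, mul_zero]
    intro h
    apply hτ
    funext a
    refine Equiv.ext fun j => ?_
    have := h (e.symm (a, j))
    simp only [Equiv.apply_symm_apply] at this
    exact this.symm
  · intro h; exact absurd (Finset.mem_univ σ) h

/-- **Summing against a block sign**: `∑_u ζ_e(u) F(u) = ∑_{σ ∈ S_N^δ} (∏_a sgn σ_a) F(w_σ)`.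
[cite: BurgisserIkenmeyer2017, eq. (3.4)] -/
theorem sum_wordBlockSign_mul {D δ N : ℕ} (e : Fin D ≃ Fin δ × Fin N) (F : Word N D → ℂ) :
    ∑ u, wordBlockSign ℂ e u * F u =
      ∑ σ : Fin δ → Equiv.Perm (Fin N), (∏ a, ((Equiv.Perm.sign (σ a) : ℤ) : ℂ)) * F (fun q => σ (e q).1 (e q).2) := by
  classical
  have key : ∀ u : Word N D, wordBlockSign ℂ e u * F u =
      ∑ σ : Fin δ → Equiv.Perm (Fin N), (∏ a, ((Equiv.Perm.sign (σ a) : ℤ) : ℂ)) *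
        (if ∀ q, u q = σ (e q).1 (e q).2 then 1 else 0) * F u := fun u => by
    rw [← sum_prod_sign_mul_ite_eq_wordBlockSign, Finset.sum_mul]
  rw [Finset.sum_congr rfl fun u _ => key u, Finset.sum_comm]
  refine Finset.sum_congr rfl fun σ _ => ?_
  rw [Finset.sum_eq_single (fun q => σ (e q).1 (e q).2)]
  · simp
  · intro u _ hu
    rw [if_neg (fun h => hu (funext h)), mul_zero, zero_mul]
  · intro h; exact absurd (Finset.mem_univ _) h

/-- The product of the signs of a family squared is `1`. [folklore] -/
theorem prod_sign_mul_self {δ N : ℕ} (σ : Fin δ → Equiv.Perm (Fin N)) :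
    (∏ a, ((Equiv.Perm.sign (σ a) : ℤ) : ℂ)) * ∏ a, ((Equiv.Perm.sign (σ a) : ℤ) : ℂ) = 1 := by
  rw [← Finset.prod_mul_distrib]
  refine Finset.prod_eq_one fun a _ => ?_
  rw [← Int.cast_mul, ← Units.val_mul, Int.units_mul_self, Units.val_one, Int.cast_one]

/-- The block products over a block word factor into permanents:
`∑_{σ ∈ S_N^δ} ∏_q c_{σ_{e(q)₁}(e(q)₂), w(q)} = ∏_a perm (c_{i, w(e⁻¹(a,j))})_{i,j}`. [folklore] -/
theorem sum_prod_blockWord_eq_prod_permanent {D δ N : ℕ} (e : Fin D ≃ Fin δ × Fin N) (c : Fin N → Fin N → ℂ)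
    (w : Word N D) :
    ∑ σ : Fin δ → Equiv.Perm (Fin N), ∏ q, c (σ (e q).1 (e q).2) (w q) =
      ∏ a, Matrix.permanent (Matrix.of fun i j : Fin N => c i (w (e.symm (a, j)))) := by
  classical
  have hre : ∀ σ : Fin δ → Equiv.Perm (Fin N),
      ∏ q, c (σ (e q).1 (e q).2) (w q) = ∏ a, ∏ j, c (σ a j) (w (e.symm (a, j))) := by
    intro σ
    rw [← Fintype.prod_prod_type (f := fun p : Fin δ × Fin N => c (σ p.1 p.2) (w (e.symm p)))]
    rw [← e.symm.prod_comp]  -- hmm direction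
    simp
  simp_rw [hre]
  have hex := Finset.prod_univ_sum (fun _ : Fin δ => (Finset.univ : Finset (Equiv.Perm (Fin N))))
    fun a τ => ∏ j, c (τ j) (w (e.symm (a, j)))
  rw [Fintype.piFinset_univ] at hex
  rw [← hex]
  refine Finset.prod_congr rfl fun a _ => ?_
  simp [Matrix.permanent, Matrix.of_apply]

/-! ### §3 The evaluation law -/

/-- **Evaluation law (two block structures).**  For every `M` on the third leg and every matrix `c`,
`⟪ζ_e ⊗ ζ_{e'} ⊗ M, t₀(c)^{⊗D}⟫ = ∑_{σ ∈ S_N^δ} (∏_a sgn σ_a) · ζ_{e'}(w_σ) · ∑_w M(w) ∏_q c_{w_σ(q), w(q)}`.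
[this node] -/
theorem pairing_diagSlice_blockSign_blockSign {D δ δ' N : ℕ} (e : Fin D ≃ Fin δ × Fin N) (e' : Fin D ≃ Fin δ' × Fin N)
    (M : Word N D → ℂ) (c : Fin N → Fin N → ℂ) :
    ∑ u, ∑ v, ∑ w, kroneckerPow (fun i j l : Fin N => if i = j then c i l else 0) D u v w *
        (wordBlockSign ℂ e u * wordBlockSign ℂ e' v * M w) =
      ∑ σ : Fin δ → Equiv.Perm (Fin N), (∏ a, ((Equiv.Perm.sign (σ a) : ℤ) : ℂ)) *
        (wordBlockSign ℂ e' (fun q => σ (e q).1 (e q).2) *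
          ∑ w, M w * ∏ q, c (σ (e q).1 (e q).2) (w q)) := by
  classical
  have hv : ∀ u, ∑ v, ∑ w, kroneckerPow (fun i j l : Fin N => if i = j then c i l else 0) D u v w *
      (wordBlockSign ℂ e u * wordBlockSign ℂ e' v * M w) =
      wordBlockSign ℂ e u * (wordBlockSign ℂ e' u * ∑ w, M w * ∏ q, c (u q) (w q)) := by
    intro u
    rw [Finset.sum_eq_single u]
    · rw [Finset.mul_sum, Finset.mul_sum]
      refine Finset.sum_congr rfl fun w _ => ?_
      rw [kroneckerPow_diagSlice_self]
      ring
    · intro v _ hv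
      refine Finset.sum_eq_zero fun w _ => ?_
      rw [kroneckerPow_diagSlice_of_ne c (Ne.symm hv), zero_mul]
    · intro h; exact absurd (Finset.mem_univ u) h
  simp_rw [hv]
  rw [sum_wordBlockSign_mul]

/-- **Evaluation law (one block structure): block PERMANENTS.**
`⟪ζ_e ⊗ ζ_e ⊗ M, t₀(c)^{⊗D}⟫ = ∑_w M(w) · ∏_{a<δ} perm (c_{i, w(e⁻¹(a,j))})_{i,j<N}`. [this node] -/
theorem pairing_diagSlice_blockSign_eq_sum_permanent {D δ N : ℕ} (e : Fin D ≃ Fin δ × Fin N) (M : Word N D → ℂ)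
    (c : Fin N → Fin N → ℂ) :
    ∑ u, ∑ v, ∑ w, kroneckerPow (fun i j l : Fin N => if i = j then c i l else 0) D u v w *
        (wordBlockSign ℂ e u * wordBlockSign ℂ e v * M w) =
      ∑ w, M w * ∏ a, Matrix.permanent (Matrix.of fun i j : Fin N => c i (w (e.symm (a, j)))) := by
  classical
  rw [pairing_diagSlice_blockSign_blockSign]
  have hσ : ∀ σ : Fin δ → Equiv.Perm (Fin N), (∏ a, ((Equiv.Perm.sign (σ a) : ℤ) : ℂ)) *
      (wordBlockSign ℂ e (fun q => σ (e q).1 (e q).2) * ∑ w, M w * ∏ q, c (σ (e q).1 (e q).2) (w q)) =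
      ∑ w, M w * ∏ q, c (σ (e q).1 (e q).2) (w q) := fun σ => by
    rw [wordBlockSign_blockWord, ← mul_assoc, prod_sign_mul_self, one_mul]
  rw [Finset.sum_congr rfl fun σ _ => hσ σ, Finset.sum_comm]
  refine Finset.sum_congr rfl fun w _ => ?_
  rw [← Finset.mul_sum, sum_prod_blockWord_eq_prod_permanent]

/-! ### §4 The floor law -/

/-- `ζ_e ⊗ ζ_{e'} ⊗ M ∈ HW_{(δ^N)} ⊗ HW_{(δ'^N)} ⊗ HW_ν` for a highest-weight vector `M` of weight `ν`.
[cite: BurgisserIkenmeyer2017, Thm. 5.13 (proof)] -/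
theorem blockSign_blockSign_mem_tripleHw {D δ δ' N : ℕ} (e : Fin D ≃ Fin δ × Fin N) (e' : Fin D ≃ Fin δ' × Fin N)
    {ν : Weight (Fin N)} {M : Word N D → ℂ} (hM : M ∈ highestWeightSpace (wordRep ℂ N D) ν) :
    (fun t : Word3 N D => wordBlockSign ℂ e t.1.1 * wordBlockSign ℂ e' t.1.2 * M t.2) ∈
      tripleHw ℂ N D (Weight.ofPartition N (Nat.Partition.rectangle N δ))
        (Weight.ofPartition N (Nat.Partition.rectangle N δ')) ν := by
  rw [mem_tripleHw_iff]
  refine ⟨fun w₂ w₃ => ?_, fun w₁ w₃ => ?_, fun w₁ w₂ => ?_⟩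
  · have h : (fun w₁ : Word N D => wordBlockSign ℂ e w₁ * wordBlockSign ℂ e' w₂ * M w₃) =
        (wordBlockSign ℂ e' w₂ * M w₃) • wordBlockSign ℂ e := by
      funext w₁; simp only [Pi.smul_apply, smul_eq_mul]; ring
    rw [h]
    exact Submodule.smul_mem _ _ (wordBlockSign_mem_highestWeightSpace ℂ _)
  · have h : (fun w₂ : Word N D => wordBlockSign ℂ e w₁ * wordBlockSign ℂ e' w₂ * M w₃) =
        (wordBlockSign ℂ e w₁ * M w₃) • wordBlockSign ℂ e' := by
      funext w₂; simp only [Pi.smul_apply, smul_eq_mul]; ring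
    rw [h]
    exact Submodule.smul_mem _ _ (wordBlockSign_mem_highestWeightSpace ℂ _)
  · have h : (fun w₃ : Word N D => wordBlockSign ℂ e w₁ * wordBlockSign ℂ e' w₂ * M w₃) =
        (wordBlockSign ℂ e w₁ * wordBlockSign ℂ e' w₂) • M := by
      funext w₃; simp only [Pi.smul_apply, smul_eq_mul]
    rw [h]
    exact Submodule.smul_mem _ _ hM

/-- **The two-rectangle floor law (general witness).**  Let `λ⁰ = λ¹ = (δ^N)` and let `M` be a highest-weight vector of weight
`λ²` on words of length `Nδ`.  If for some matrix `c` and block structures `e, e'` the block sum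
`∑_σ sgn(σ) ζ_{e'}(w_σ) ∑_w M(w) ∏_q c_{w_σ(q),w(q)}` is non-zero, then `(λ⁰,λ¹,λ²)` occurs for `⟨m⟩` for every `m ≥ N`:
the diagonal-slice tensor `t₀(c)` has border rank `≤ N` and the pairing of §3 is an occurrence witness. [this node] -/
theorem occurs_unitTensor_twoRectangle_of_pairing_ne_zero {N δ m : ℕ} (hNm : N ≤ m)
    (e e' : Fin (N * δ) ≃ Fin δ × Fin N) {lam : Fin 3 → Nat.Partition (N * δ)}
    (h0 : lam 0 = Nat.Partition.rectangle N δ) (h1 : lam 1 = Nat.Partition.rectangle N δ)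
    {M : Word N (N * δ) → ℂ} (hM : M ∈ highestWeightSpace (wordRep ℂ N (N * δ)) (Weight.ofPartition N (lam 2)))
    (c : Fin N → Fin N → ℂ)
    (h : ∑ σ : Fin δ → Equiv.Perm (Fin N), (∏ a, ((Equiv.Perm.sign (σ a) : ℤ) : ℂ)) *
        (wordBlockSign ℂ e' (fun q => σ (e q).1 (e q).2) *
          ∑ w, M w * ∏ q, c (σ (e q).1 (e q).2) (w q)) ≠ 0) :
    isotypicSum₁ (lam 0) (isotypicSum₂ (lam 1) (isotypicSum₃ (lam 2) (kroneckerPow (unitTensor ℂ m) (N * δ)))) ≠ 0 := by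
  classical
  refine occurs_unitTensor_of_algBorderRank_le hNm _ ((algBorderRank_diagSlice_le c).trans hNm) (N * δ) lam ?_
  have hmem : (fun t : Word3 N (N * δ) => wordBlockSign ℂ e t.1.1 * wordBlockSign ℂ e' t.1.2 * M t.2) ∈
      tripleHw ℂ N (N * δ) (Weight.ofPartition N (lam 0)) (Weight.ofPartition N (lam 1))
        (Weight.ofPartition N (lam 2)) := by
    rw [h0, h1]; exact blockSign_blockSign_mem_tripleHw e e' hM
  refine isotypicSum₁₂₃_kroneckerPow_ne_zero_of_pairing_tripleHw_ne_zero hmem ?_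
  rw [show (∑ u, ∑ v, ∑ w, kroneckerPow (fun i j l : Fin N => if i = j then c i l else 0) (N * δ) u v w *
      (fun t : Word3 N (N * δ) => wordBlockSign ℂ e t.1.1 * wordBlockSign ℂ e' t.1.2 * M t.2) ((u, v), w)) =
      ∑ u, ∑ v, ∑ w, kroneckerPow (fun i j l : Fin N => if i = j then c i l else 0) (N * δ) u v w *
        (wordBlockSign ℂ e u * wordBlockSign ℂ e' v * M w) from rfl]
  rwa [pairing_diagSlice_blockSign_blockSign]

/-- **The two-rectangle floor law (permanent form).**  With `e' = e`: if `∑_w M(w) ∏_{a<δ} perm(c_{i,w(a,j)})_{i,j} ≠ 0` for a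
highest-weight vector `M` of weight `λ²` and one `N × N` matrix `c`, then `((δ^N),(δ^N),λ²) ∈ S(⟨m⟩)` for all `m ≥ N` — the
type is NOT an occurrence obstruction against any border-rank bound `≥ N`. [this node] -/
theorem occurs_unitTensor_twoRectangle_of_permanentPairing_ne_zero {N δ m : ℕ} (hNm : N ≤ m)
    (e : Fin (N * δ) ≃ Fin δ × Fin N) {lam : Fin 3 → Nat.Partition (N * δ)}
    (h0 : lam 0 = Nat.Partition.rectangle N δ) (h1 : lam 1 = Nat.Partition.rectangle N δ)
    {M : Word N (N * δ) → ℂ} (hM : M ∈ highestWeightSpace (wordRep ℂ N (N * δ)) (Weight.ofPartition N (lam 2)))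
    (c : Fin N → Fin N → ℂ)
    (h : ∑ w, M w * ∏ a, Matrix.permanent (Matrix.of fun i j : Fin N => c i (w (e.symm (a, j)))) ≠ 0) :
    isotypicSum₁ (lam 0) (isotypicSum₂ (lam 1) (isotypicSum₃ (lam 2) (kroneckerPow (unitTensor ℂ m) (N * δ)))) ≠ 0 := by
  classical
  refine occurs_unitTensor_of_algBorderRank_le hNm _ ((algBorderRank_diagSlice_le c).trans hNm) (N * δ) lam ?_
  have hmem : (fun t : Word3 N (N * δ) => wordBlockSign ℂ e t.1.1 * wordBlockSign ℂ e t.1.2 * M t.2) ∈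
      tripleHw ℂ N (N * δ) (Weight.ofPartition N (lam 0)) (Weight.ofPartition N (lam 1))
        (Weight.ofPartition N (lam 2)) := by
    rw [h0, h1]; exact blockSign_blockSign_mem_tripleHw e e hM
  refine isotypicSum₁₂₃_kroneckerPow_ne_zero_of_pairing_tripleHw_ne_zero hmem ?_
  rw [show (∑ u, ∑ v, ∑ w, kroneckerPow (fun i j l : Fin N => if i = j then c i l else 0) (N * δ) u v w *
      (fun t : Word3 N (N * δ) => wordBlockSign ℂ e t.1.1 * wordBlockSign ℂ e t.1.2 * M t.2) ((u, v), w)) =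
      ∑ u, ∑ v, ∑ w, kroneckerPow (fun i j l : Fin N => if i = j then c i l else 0) (N * δ) u v w *
        (wordBlockSign ℂ e u * wordBlockSign ℂ e v * M w) from rfl]
  rwa [pairing_diagSlice_blockSign_eq_sum_permanent]

end Summit.MatrixMultiplication.MatrixMultiplication.Theorems.ObstructionCalculus

end
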